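import Summits.HodgeConjecture.HodgeConjecture.Theses.NikulinTwinTransport
import Summits.HodgeConjecture.HodgeConjecture.Theorems.TwinTwistorTransport.Negative.NoOddSelfAnchor
import Summits.HodgeConjecture.HodgeConjecture.Theorems.TwinTwistorTransport.Negative.TypedClauseHygiene
import Summits.HodgeConjecture.HodgeConjecture.Theorems.TwinTwistorTransport.Negative.WithoutRationalityOrHalving

/-!
# Disproof of `TwinTransportRMPicardTwo` (stmt-HodgeConjecture-15067) — findings

Standing disprover `refuter-cdisprove-stmt-HodgeConjecture-15067-0` (gen 1, cycle 1, 2026-08-16).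
Route NikulinTwinTransport r3, the judge's milestone: the conclusion of the transport crux
`TwinTwistorTransport` (14393) — a projective K3 partner `S″`, a generator `p″`, an ALGEBRAIC
`Ψ : H²(S″) ≃ H²(S)` whose inverse is (R) rational, (T) type-preserving, (H) form-halving, (A)
`Ψ = fst_*(snd^*(–) ∪ γ)` — for every projective K3 surface `S` of Picard rank `2`
(`finrank_ℂ (algebraicClasses S 1) = 2`) carrying an endomorphism `e` of `H²(S(ℂ);ℂ)` with
(eR) `e` rational, (eT) `e` type-preserving, (eNS) `e|NS = 0`, (e²) `e(e x) = 2x` on `NS^⊥`.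

## Verdict (cycle 1): NO KILL — why it resists

* `TwinTwistorTransport → TwinTransportRMPicardTwo` (planner Sketch2, two lines), and the parent is
  implied by the Hodge conjecture for the fourfolds `S × S″` (parent Disproof, Verdict): so
  `¬TwinTransportRMPicardTwo ⟹ ¬TwinTwistorTransport ⟹ ¬HodgeConjecture` (route kill criterion
  (iii)).  More directly: at a surface with real multiplication, Zarhin makes `e|T` self-adjoint, the
  landed `exists_ratCorrection` (Witt) completes it to a rational Hodge self-2-similitude
  `Ξ = e + ν̃` of `H²(S,ℚ)`, and `rmAnchor_at_of_realMultiplication_algebraic_at` (seat 13679-1)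
  turns "`e` algebraic on `S × S`" — an instance of HC — into the conclusion with `S″ = S`.  No
  non-algebraic `e` is known or expected; an unconditional `¬` is out of reach, and an honest
  `H → ¬crux` would need `H` = a counterexample to HC.
* The carriers are REAL (`complexBetti` = singular cohomology of `S(ℂ)`, `algebraicClasses` =
  coniveau `N¹`, `IsSmoothProjective` includes `GeometricallyIrreducible`): no K3 surface, let alone
  an RM one, is constructible in the tree, so no Lean-level `¬` through junk either; every
  `_false_without_` statement below is proved on the linear-algebra SHADOW, except §A/A1 and the
  LANDED real-carrier file of §B.
* EVERY weakening of the `S`-side hypotheses (drop `ρ = 2`, drop (eR), (eT), (eNS) or (e²)) sits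
  between the parent crux and this one, hence is HC-implied too: no `_false_without_<H>` exists for
  them.  What the attack CAN measure is which clause carries the "real multiplication" restriction:

## Load-bearing analysis of the `e`-block (new w.r.t. the parent)

* A1 (REAL CARRIERS, `Negative/EBlockAlgebra.lean`, p101522) `algebraicClass_perp_eq_zero_of_eBlock`:
  (eNS)+(e²) alone force `NS ∩ NS^⊥ = 0` (`2d = e(e d) = 0`) — for every `ℂ`-scheme, no facts;
  A1′ `eBlock_map_mem_perp`, `eBlock_sq_smul_on_perp` (same file, modulo the four facts behind
  `exists_nsProjection`): (eNS)+(e²) force `e(NS^⊥) ⊆ NS^⊥` and `e³ = 2e` there ON THE REAL CARRIERS.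
* A2/A3 (shadow) `map_mem_of_eBlock`, `eBlock_eq_comp_projection`: on `V = N ⊕ W`, (eNS)+(e²) force
  `e(W) ⊆ W`; so `e = J ∘ P_W` with `J ∈ End(NS^⊥)`, `J² = 2`.  The docstring's appeal to the
  irreducibility of `T(S)` ("a Hodge morphism `T → NS` vanishes") is unnecessary.
* B1 (shadow) `eBlock_without_rationality` + LANDED REAL-CARRIER VERSION (p98771,
  `Theorems/TwinTransportRMPicardTwo/Negative/WithoutRationalityClause.lean`:
  `exists_junk_eBlock`, `atRankTwo_of_withoutER`, `withoutER_of_atRankTwo`,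
  `atRankTwo_of_twinTwistorTransport`): WITHOUT (eR) the block is met on EVERY projective K3 by the
  junk `e = c • (𝟙 − π_N)`, `c² = 2` (`exists_nsProjection`, modulo markings / `N¹ ⊆ F¹` / Hodge
  index / `CupPreservesHodgeType`), so crux−(eR) ⟺ parent crux restricted to `ρ = 2` (= the crux with
  the whole `e`-block deleted, verbatim).  (eR) CARRIES THE WHOLE RM CONTENT — exactly as (R) does on
  the conclusion side (parent T1/T1′).
* B2/B3 (shadow) `eBlock_without_types`, `exists_sq_two_operator_prod` + LANDED REAL-CARRIER VERSION
  (p100573, `Theorems/TwinTransportRMPicardTwo/Negative/WithoutTypeClause.lean`: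
  `exists_rational_junk_eBlock`, `atRankTwo_of_withoutET`, `withoutET_of_atRankTwo`): WITHOUT (eT) a
  RATIONAL junk block exists on every projective K3 of Picard rank 2 — through a marking `η`,
  `dim_ℚ T_ℚ = 20` (from `H² = NS ⊕ T`, rational spanning of `NS` and `T`, `NS_ℚ ∩ T_ℚ = 0`), so
  `T_ℚ ≅ ℚ¹⁰ × ℚ¹⁰` carries `J(u,v) = (2v,u)`, and `e = η⁻¹ ∘ (J ⊕ 0)_ℂ ∘ η ∘ (𝟙 − π_N)` passes
  (eR), (eNS), (e²): crux−(eT) is again the parent at `ρ = 2`.  So (eR) and (eT) are EACH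
  load-bearing and only JOINTLY single out the RM surfaces; a proof using real multiplication must
  use both.
* B4 (shadow) `even_of_sq_two_operator`: a rational `J² = 2` forces even rank (`det J² = 2ⁿ`, the
  parent's `rat_sq_ne_odd_pow_two_mul_sq`): the block is vacuous for odd `ρ`; `ρ = 2` is the first
  case and `rk T = 20` is even, so the parent's odd-rank obstruction `no_self_twoSimilitude_of_odd`
  to the SELF-anchor does not bite here — the line's `S″ := S` is legal.
* (eNS) is mathematically REDUNDANT given (eR),(eT),(e²) (on a K3, `T_ℚ` is irreducible, so the
  `NS → T` and `T → NS` components of a Hodge endomorphism vanish and `e|T` still squares to `2`):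
  "possibly unnecessary", harmless, and convenient (the line never uses `e` except to feed stub 5).
* `ρ = 2` is not load-bearing for truth (all even `ρ` are HC-implied alike) — it is the judge's
  choice of the first open case (`ρ ≥ 9` known on the Nikulin / even-eight loci, parent Disproof).
* C1 (shadow) `halving_at_zero_generator_forces_zero`: the generator clause on `p` is load-bearing
  for the CONCLUSION: run with `p = 0`, (H) forces `p″ = 0`, impossible for a generator of
  `H⁴(S″;ℤ) ∋ [pt]`.  (Sign of `p`, the outer `∀ μ`, and (R)(T)(H)(A) hygiene: parent T2, T4–T9,
  landed `TwinTwistorTransport/Negative/TypedClauseHygiene.lean` — they apply verbatim, not redone.)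

## The self-anchor at `ρ = 2` (the line's closing move) — consistent, with one docstring caveat
`Ψ = e ⊕ ν` needs a rational 2-similitude `ν` of `NS_ℚ`.  For `Pic ≅ U(r)` (van Geemen–Schütt
arXiv:2310.05196 Thm 3.10, read p. 7: "for any squarefree d > 0 and any r > 0 there is an
8-dimensional family … very general member has Pic(X) ≅ U(r) and RM by ℚ(√d)", `T = U ⊕ U(r) ⊕ E₈²`)
`ν = diag(1,2)` works.  In general it exists by Witt cancellation from `Λ_ℚ(2) ≅ Λ_ℚ`
(`EEightTwoSimilitude`, landed `exists_ratCorrection`) — equivalently, by Hilbert reciprocity: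
`disc NS_ℚ · disc T_ℚ = −1`, RM-√2 with self-adjoint `e` makes `T_ℚ` a trace form from `ℚ(√2)` so
`−disc NS_ℚ = n ∈ N(ℚ(√2)^×)ℚ^{×2}`, and `NS_ℚ ≃ ⟨a⟩⊗⟨1,−n⟩` admits multiplier `2` iff
`(2,n)_ℚ = 1` iff `(n,2)_ℚ = 1` — the same condition.  CAVEAT for planners: the item docstring's
"such S are exactly the Picard-rank-2 members of the maximal families, Pic = U(r)" overstates what
vGS prove — p. 7: "We do not know of other families of maximal dimension, but their existence is quite
likely"; anisotropic `NS` (e.g. `⟨2⟩ ⊕ ⟨−4⟩`, `n = 2 = N(2+√2)`) is Hodge-theoretically admissible.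
Harmless for the crux (a `∀ S`), relevant for any `LatticeTypeExhaustion` sub-plan.

## Line `Sketch` (lead 15067-0; dihedral Hecke octagon) — stub-by-stub (payload.line; targets = [])
* `TwinTransportRMPicardTwo_of` is kernel-checked: joint sufficiency of the five stubs is certified.
* stub 1 `stub_pushPull_spec`: known mathematics on the tree's Gysin calculus; robust to junk `c`
  (`algebraicClasses` is a `ℂ`-subspace, rationality is conditional). No attack.
* stub 2 `stub_hecke_algebra`: conclusion (2) `T² = 2` is GEOMETRY-FREE operator algebra — D1
  `hecke_sq_two_of_transfer` proves its shadow from `AA' = A'A = 1`, transfer, `QP = 1`, `A⁴ = −1`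
  (cf. the ideator's `hecke_sq_eq_two`); only (1) self-adjointness has content (projection formula
  `complexGysin_cup` + `σ^* = 1` on `H⁴(W)`, automatic for automorphisms of irreducible `W`).
* stub 3 `stub_rm_of_hecke`: sound (`e' = T ∘ (1 − π_N)`; `T` self-adjoint with `T(NS) ⊆ NS` gives
  `T(NS^⊥) ⊆ NS^⊥`, so `e'² = T² = 2` there; `T ∘ π_N` = divisor correspondences).
* stub 4 `stub_k3Facts`: the `∀ X, hodgeIndex_surface X` conjunct is safe ONLY because
  `IsSmoothProjective` carries `GeometricallyIrreducible` (on `P¹×P¹ ⊔ P¹×P¹` the sign-free index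
  statement fails: `h^⊥ ≅ ⟨−a,1,−1⟩` is isotropic for every `h`); as typed it is the named fact.
* stub 5 `stub_octagonalPresentation` (conjecture C⁺, THE HEART) — no cheap kill, three findings:
  - D2 `trivial_sigma_forces_perp_zero`: no junk witness — `W = S`, `σ = 𝟙` passes every clause but
    `σ^{*4} = −1` on `π^*NS^⊥`, which then forces `NS^⊥ = 0`.
  - D3 `no_fourth_root_of_neg_one` + paper: for a NON-CM member (`End_Hdg T(S)_ℚ = ℚ(√2) ⊂ ℝ`) the
    image `π^*T(S)_ℚ ⊂ H²(W,ℚ)` is NOT `σ^*`-stable (else `σ^*|` is a unit of a real field with 4th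
    power `−1`); `T(S)_ℚ` irreducible then gives `π^*T ⊕ σ^*π^*T ≅ T(S)_ℚ² ↪ H²(W,ℚ)`, so
    `p_g(W) ≥ 2`: `W` is never a K3 and never `S` itself off the `ζ₈`-CM locus (a 4-dimensional
    ball-quotient sub-locus at best).  For `ρ(S) = 2` a quotient-type `π` of degree 2 is, up to
    blow-ups, a double cover branched along a curve `B ∈ |2L|` with at most one `A₁` point (an
    involution with `k` isolated fixed points costs `k` disjoint `(−2)`-curves on `S`, `k ≤ ρ − 1 = 1`;
    no étale double cover of a K3 exists); in the basic model `p_g(W) = h⁰(L) + 1`, `e(W) = 48 + 4L²`.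
  - Literature (vGS arXiv:2310.05196, read pp. 9–10): the dihedral Dickson construction Prop 4.6 is
    stated for `n ∈ {5,7,11}` and its proof §4.7 USES `n` prime (`ℚ[T]/(Tⁿ−1) ≅ ℚ × ℚ(ζₙ)`); for
    `n = 8` the isotypic type of `T_a` among `ℚ × ℚ × ℚ(i) × ℚ(ζ₈)` is undetermined by that argument,
    and the analogous Weierstrass family `Y² = X³ + (a₀+a₁p_{8,a}(x))X + (b₀+b₁p_{8,a}(x))` has a
    `III^*` fibre on the rational quotient, Mordell–Weil rank 1 there, hence `ρ ≥ 3` upstairs — it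
    MISSES the `ρ = 2` class of the crux.  Rem 4.9 (p. 10): "a priori no reason to assume that the
    real multiplication is induced by a cycle with two irreducible components … such K3 surfaces are
    quite special among those with RM … confirmed by the fact that in various examples we do not find
    maximal families".  So C⁺ asserts for EVERY member what the authors expect only for special
    members: the lead's B-oct barrier is the authors' own expectation, not merely a possibility.  Not
    a refutation (no dimension count of `D₈`-presentations is in print); recommendation to the lead:
    make the cheapest falsifier a PARAMETER COUNT of pairs `(W, D₈)` with `W/τ` birational to a
    `U(r)`-polarised K3, before investing in stubs 1–3.

## Literature
Degraded this cycle: `lit search` rc 75 (searchd unavailable, 3 attempts 10:45–11:40Z).  Held and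
READ: van Geemen–Schütt arXiv:2310.05196 (doi:10.1017/fms.2024.146) pp. 6–7 (§3.4, Thm 3.10 + proof),
9–10 (§4.1–4.9).  Inherited from the parent Disproof: Varesco 2023 §2 (similitudes algebraic on the
Nikulin locus only), Schlickewei 2010 (RM examples with HC for `S × S`).  No printed candidate
counterexample to algebraicity of `√2` on any K3.

## LANDED / proposed from this cycle (importable: `…Theorems.TwinTransportRMPicardTwo.Negative.*`)
* p98771 ACCEPTED @4fa1f66ab806 `Negative/WithoutRationalityClause.lean` (real carriers; statements
  inlined; reuses `TwinTwistorTransport.Negative.exists_complex_mul_self_eq_two`).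
* p100573 ACCEPTED @ebc54a093a26 `Negative/WithoutTypeClause.lean` (real carriers; statements
  inlined; p100059 was the same file bounced for a missing docstring).
* p101522 ACCEPTED @a5885b7f1075 `Negative/EBlockAlgebra.lean` (A1/A1′, real carriers).
This work file keeps shadow copies so that it elaborates standalone.

## Targets
`payload.targets = []`, `stuck_stubs = []`: no stub kills requested; §D records the line findings.
-/

namespace Summit.HodgeConjecture.HodgeConjecture.Cruxes.TwinTransportRMPicardTwo.Disproof

open scoped BigOperators Matrix

/-! ## §A — the `e`-block on the REAL carriers: `NS ∩ NS^⊥ = 0` and `e(NS^⊥) ⊆ NS^⊥` are forced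

A1 `algebraicClass_perp_eq_zero_of_eBlock` (no facts), A1′ `eBlock_map_mem_perp` and
`eBlock_sq_smul_on_perp` (modulo the four facts behind `exists_nsProjection`) live in the LANDED
`Theorems/TwinTransportRMPicardTwo/Negative/EBlockAlgebra.lean` (p101522; namespace
`…Theorems.TwinTransportRMPicardTwo.Negative`); they are not duplicated here so that the proposal
is not a near-duplicate of this work file.  Shadow versions follow. -/

/-! ## §A′ — shadow: (eNS)+(e²) force `e (NS^⊥) ⊆ NS^⊥` once `H² = NS ⊕ NS^⊥` -/

section Shadow

variable {K V : Type*} [Field K] [AddCommGroup V] [Module K V]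

/-- A2 (SHADOW — `e` PRESERVES `NS^⊥` AUTOMATICALLY).  On `V = N ⊕ W` (think `H²(S,ℚ) = NS ⊕ T`),
a linear `e` with `e|N = 0` and `e (e x) = 2x` on `W` maps `W` into `W`: writing `e x = n + w`,
`2x = e(e x) = e w` and `e(e w) = 2w` give `2 • e x = 2 • w`.  So the docstring's appeal to the
irreducibility of `T(S)` ("a Hodge morphism `T → NS` vanishes") is not needed: the algebra of the two
clauses alone makes `e|_{NS^⊥}` an endomorphism `J` of `NS^⊥` with `J² = 2`. [folklore] -/
theorem map_mem_of_eBlock (h2 : (2 : K) ≠ 0) {N W : Submodule K V} (hNW : IsCompl N W)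
    (e : V →ₗ[K] V) (he_N : ∀ d ∈ N, e d = 0) (he_W : ∀ x ∈ W, e (e x) = (2 : K) • x)
    {x : V} (hx : x ∈ W) : e x ∈ W := by
  have hsup : e x ∈ N ⊔ W := by
    rw [hNW.sup_eq_top]
    exact Submodule.mem_top
  obtain ⟨n, hn, w, hw, hsum⟩ := Submodule.mem_sup.mp hsup
  have h1 : e (e x) = e w := by
    rw [← hsum, map_add, he_N n hn, zero_add]
  have hx2 : e w = (2 : K) • x := by
    rw [← h1, he_W x hx]
  have h3 : (2 : K) • e x = (2 : K) • w := by
    rw [← map_smul, ← hx2, he_W w hw]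
  have h4 : e x = w := smul_right_injective V h2 h3
  rw [h4]
  exact hw

/-- A3 (SHADOW).  Consequently `e² = 2` holds on all of `W` as an identity of endomorphisms of `W`
and `e = J ∘ P_W` for the projection `P_W` along `N`: the `e`-block is exactly the datum of
`J ∈ End(W)` with `J² = 2`. [folklore] -/
theorem eBlock_eq_comp_projection {N W : Submodule K V} (hNW : IsCompl N W)
    (e : V →ₗ[K] V) (he_N : ∀ d ∈ N, e d = 0) (v : V) :
    e v = e ((Submodule.prodEquivOfIsCompl N W hNW).symm v).2 := by
  conv_lhs => rw [← (Submodule.prodEquivOfIsCompl N W hNW).apply_symm_apply v]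
  rw [Submodule.coe_prodEquivOfIsCompl', map_add, he_N _ (Submodule.coe_mem _), zero_add]

/-! ## §B — shadow: WITHOUT (eR) or WITHOUT (eT) the `e`-block is junk-satisfiable on every
`ρ = 2` surface, so the crux degenerates to the parent crux `TwinTwistorTransport` at `ρ = 2` -/

/-- B1 (WITHOUT RATIONALITY (eR) — junk `e = √2 · P_{NS^⊥}`).  On `V = N ⊕ W` over any field
containing `c` with `c² = 2`, the map `e := 0 ⊕ c • id_W` kills `N`, squares to `2` on `W`, and
preserves every subspace `H` that is split by the decomposition (`H = (H ∩ N) + (H ∩ W)` — on a K3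
surface: `H^{2,0}, H^{0,2} ⊆ T_ℂ`, `H^{1,1} = NS_ℂ ⊕ (H^{1,1} ∩ T_ℂ)`), i.e. it passes (eNS), (e²)
and the type clause (eT).  Only (eR) fails (`√2 ∉ ℚ`).  Upshot: the crux with (eR) deleted is the
parent crux restricted to Picard rank `2` (every `ρ = 2` K3 qualifies) — open, HC-implied, and NOT
the judge's RM milestone; any proof exploiting real multiplication must use (eR). [folklore] -/
theorem eBlock_without_rationality {N W : Submodule K V} (hNW : IsCompl N W) {c : K}
    (hc : c * c = 2) :
    ∃ e : V →ₗ[K] V, (∀ d ∈ N, e d = 0) ∧ (∀ x ∈ W, e (e x) = (2 : K) • x) ∧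
      ∀ H : Submodule K V, (∀ h ∈ H, ∃ n ∈ N, ∃ w ∈ W, n ∈ H ∧ w ∈ H ∧ n + w = h) →
        ∀ h ∈ H, e h ∈ H := by
  refine ⟨LinearMap.ofIsCompl hNW 0 (c • W.subtype), ?_, ?_, ?_⟩
  · intro d hd
    exact LinearMap.ofIsCompl_apply_left hNW (⟨d, hd⟩ : N)
  · intro x hx
    have hx1 : LinearMap.ofIsCompl hNW 0 (c • W.subtype) x = c • x :=
      LinearMap.ofIsCompl_apply_right hNW (⟨x, hx⟩ : W)
    have hx2 : LinearMap.ofIsCompl hNW 0 (c • W.subtype) (c • x) = c • (c • x) := by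
      rw [map_smul, hx1]
    rw [hx1, hx2, smul_smul, hc]
  · intro H hH h hh
    obtain ⟨n, hn, w, hw, hnH, hwH, rfl⟩ := hH h hh
    rw [map_add]
    have e1 : LinearMap.ofIsCompl hNW 0 (c • W.subtype) n = 0 :=
      LinearMap.ofIsCompl_apply_left hNW (⟨n, hn⟩ : N)
    have e2 : LinearMap.ofIsCompl hNW 0 (c • W.subtype) w = c • w :=
      LinearMap.ofIsCompl_apply_right hNW (⟨w, hw⟩ : W)
    rw [e1, e2, zero_add]
    exact H.smul_mem c hwH

/-- B2 (WITHOUT THE TYPE CLAUSE (eT) — junk RATIONAL `e`).  On `V = N ⊕ W` over ANY field (so over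
`ℚ`: rationality is automatic), every `J ∈ End(W)` with `J² = 2` extends by zero on `N` to an `e`
passing (eNS) and (e²); and such `J` exists as soon as `W ≅ P × P` has even dimension (B3:
`J(u,v) = (2v,u)`; `rk T(S) = 20`).  Upshot: the crux with (eT) deleted is again the parent crux at
`ρ = 2`; any proof exploiting real multiplication must use (eT) as well. [folklore] -/
theorem eBlock_without_types {N W : Submodule K V} (hNW : IsCompl N W) (J : W →ₗ[K] W)
    (hJ : ∀ w : W, J (J w) = (2 : K) • w) :
    ∃ e : V →ₗ[K] V, (∀ d ∈ N, e d = 0) ∧ (∀ x ∈ W, e (e x) = (2 : K) • x) ∧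
      ∀ x ∈ W, e x ∈ W := by
  refine ⟨LinearMap.ofIsCompl hNW 0 (W.subtype ∘ₗ J), ?_, ?_, ?_⟩
  · intro d hd
    exact LinearMap.ofIsCompl_apply_left hNW (⟨d, hd⟩ : N)
  · intro x hx
    have hx1 : LinearMap.ofIsCompl hNW 0 (W.subtype ∘ₗ J) x = W.subtype (J ⟨x, hx⟩) :=
      LinearMap.ofIsCompl_apply_right hNW (⟨x, hx⟩ : W)
    have hx2 : LinearMap.ofIsCompl hNW 0 (W.subtype ∘ₗ J) (W.subtype (J ⟨x, hx⟩)) =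
        W.subtype (J (J ⟨x, hx⟩)) :=
      LinearMap.ofIsCompl_apply_right hNW (J ⟨x, hx⟩)
    rw [hx1, hx2, hJ, map_smul]
    rfl
  · intro x hx
    have hx1 : LinearMap.ofIsCompl hNW 0 (W.subtype ∘ₗ J) x = W.subtype (J ⟨x, hx⟩) :=
      LinearMap.ofIsCompl_apply_right hNW (⟨x, hx⟩ : W)
    rw [hx1]
    exact Submodule.coe_mem _

/-- B3.  A square root of `2 • id` on every `P × P` (so on `ℚ²⁰ = ℚ¹⁰ × ℚ¹⁰ ≅ T(S)_ℚ`):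
`J (u, v) = (2v, u)`. [folklore] -/
theorem exists_sq_two_operator_prod (P : Type*) [AddCommGroup P] [Module K P] :
    ∃ J : (P × P) →ₗ[K] (P × P), ∀ z, J (J z) = (2 : K) • z :=
  ⟨((2 : K) • LinearMap.snd K P P).prod (LinearMap.fst K P P), fun z => by
    ext <;> simp [two_smul]⟩

/-- B4 (PARITY).  A rational operator with `J² = 2` lives only in EVEN dimension:
`det(J)² = 2ⁿ`.  So the `e`-block is vacuous for odd `rk NS^⊥`, i.e. (with `b₂ = 22`) for odd
Picard rank — consistent with `ρ = 2`, and the reason the milestone could not have been posed at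
`ρ = 1`. Uses the landed `Negative.rat_sq_ne_odd_pow_two_mul_sq` of the parent crux. [folklore] -/
theorem even_of_sq_two_operator {n : ℕ} (J : (Fin n → ℚ) →ₗ[ℚ] (Fin n → ℚ))
    (hJ : J ∘ₗ J = (2 : ℚ) • LinearMap.id) : Even n := by
  by_contra hodd
  rw [Nat.not_even_iff_odd] at hodd
  obtain ⟨k, rfl⟩ := hodd
  have hdet := congrArg LinearMap.det hJ
  rw [LinearMap.det_comp, LinearMap.det_smul, LinearMap.det_id, Module.finrank_fin_fun] at hdet
  exact Theorems.TwinTwistorTransport.Negative.rat_sq_ne_odd_pow_two_mul_sq (LinearMap.det J) 1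
    one_ne_zero k (by rw [sq, hdet]; ring)

/-! ## §C — shadow: the generator clause on `p` is load-bearing for the conclusion -/

/-- C1 (WITHOUT "`p` GENERATES" THE CONCLUSION COLLAPSES).  If the halving clause (H) of the
conclusion is run with `p = 0` (allowed once the hypothesis "`p` is an integral generator of
`H⁴(S(ℂ);ℤ)`" is dropped), then `b • p″ = Ψ⁻¹0.Ψ⁻¹0` for every `b`, whence `p″ = 0` — but `p″`
must generate the integral classes of `H⁴(S″(ℂ))`, which are not all zero on a K3 surface
(`[pt] ≠ 0`; in the tree via `Huybrechts_K3_marking_exists`: `p ≠ 0`).  So the crux with the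
generator clause deleted is false as soon as one RM-√2 surface of Picard rank 2 exists (van
Geemen–Schütt 2023 Thm 3.10) — recorded on the shadow, the surfaces not being constructible.
[folklore] -/
theorem halving_at_zero_generator_forces_zero {V V'' L : Type*} [AddCommGroup V] [Module K V]
    [AddCommGroup V''] [Module K V''] [AddCommGroup L] [Module K L]
    (cup : V →ₗ[K] V →ₗ[K] L) (cup'' : V'' → V'' → L) (N : V → V'') (p'' : L)
    (hH : ∀ (u v : V) (b : K), cup u v = (2 * b) • (0 : L) → cup'' (N u) (N v) = b • p'') :
    p'' = 0 := by
  have h1 := hH 0 0 1 (by simp)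
  have h0 := hH 0 0 0 (by simp)
  rw [zero_smul] at h0
  rw [h0, one_smul] at h1
  exact h1.symm

/-! ## §D — the picked line `Sketch` (dihedral Hecke octagon): shadows of stubs 2 and 5 -/

/-- D1 (STUB 2, CONCLUSION (2), IS GEOMETRY-FREE).  Operators `P = π^*`, `Q = c π₊`, `A = σ^*`,
`A' = σ'^*` with `A A' = A' A = 1`, the transfer identity `P (T x) = A (P x) + A' (P x)` for
`T = Q (A + A') P` and the normalisation `Q (P x) = x` give `T (T x) = 2x` wherever
`A⁴ (P x) = -P x` — by `A'²A⁴ = A²`, with no projection formula, no `H⁴`, no surfaces.  (Conclusion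
(1), cup-self-adjointness, is the only part of `stub_hecke_algebra` with geometric content:
projection formula `complexGysin_cup` + `σ^* = 1` on `H⁴(W)`.) [folklore; vGS 2023 §4.7–4.8] -/
theorem hecke_sq_two_of_transfer {R V U : Type*} [CommRing R] [AddCommGroup V] [Module R V]
    [AddCommGroup U] [Module R U] (P : V →ₗ[R] U) (Q : U →ₗ[R] V) (A A' : U →ₗ[R] U)
    (T : V →ₗ[R] V) (hT : ∀ x, T x = Q (A (P x) + A' (P x)))
    (hAA' : ∀ u, A (A' u) = u) (hA'A : ∀ u, A' (A u) = u)
    (htransfer : ∀ x, P (T x) = A (P x) + A' (P x)) (hQP : ∀ x, Q (P x) = x)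
    {x : V} (h8 : A (A (A (A (P x)))) = -P x) : T (T x) = (2 : R) • x := by
  have key : A' (A' (P x)) = -(A (A (P x))) := by
    have h := congrArg (fun u => A' (A' u)) h8
    simp only [hA'A, map_neg] at h
    rw [h, neg_neg]
  rw [hT (T x), htransfer x]
  simp only [map_add, map_neg, hAA', hA'A, key, hQP]
  rw [two_smul]
  abel

/-- D2 (STUB 5 HAS NO JUNK WITNESS WITH `σ = 𝟙`).  If `A = 1` then the octagonal clause
`A⁴ (P x) = -P x` on `NS^⊥` forces `P x = 0`, hence `x = Q (P x) = 0`: the trivial presentation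
`W = S`, `π = σ = σ' = 𝟙`, `c = 1` (which passes every other clause of `stub_octagonalPresentation`:
`c π₊π^* = 1` by `complexGysin_id`, transfer `2y = y + y`) would force `NS^⊥ = 0`, i.e. `b₂(S) = ρ(S)
= 2`.  So stub 5 cannot close by junk; a genuine order-8 symmetry is required. [folklore] -/
theorem trivial_sigma_forces_perp_zero {U' : Type*} [AddCommGroup U'] [Module K U']
    (h2 : (2 : K) ≠ 0) (P : V →ₗ[K] U') (Q : U' →ₗ[K] V) (hQP : ∀ x, Q (P x) = x)
    {x : V} (h8 : P x = -P x) : x = 0 := by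
  have hPx : P x = 0 := by
    have h : (2 : K) • P x = 0 := by
      rw [two_smul]
      nth_rewrite 2 [h8]
      exact add_neg_cancel _
    exact (smul_eq_zero.mp h).resolve_left h2
  rw [← hQP x, hPx, map_zero]

/-- D3 (ORDER 8 NEEDS TWO COPIES OF `T(S)`).  In a formally real field (here `ℝ ⊇ ℚ(√2) =
End_Hdg T(S)_ℚ` of the general RM member) `x⁴ = -1` has no solution.  Consequence (paper, §E of the
module docstring): for a non-CM member `S`, the subspace `π^* T(S)_ℚ ⊂ H²(W,ℚ)` of an octagonal
presentation is NOT `σ^*`-stable (else `σ^*|` would be an element of `End_Hdg(T(S)_ℚ)^× ⊂ ℝ^×` with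
fourth power `-1`), so `π^*T ⊕ σ^*π^*T ≅ T(S)_ℚ²` embeds in `H²(W,ℚ)` and `p_g(W) ≥ 2`: the cover
`W` is never a K3 surface, and `W = S` is possible only at CM members with `ζ₈ ∈ End_Hdg T(S)`.
[folklore] -/
theorem no_fourth_root_of_neg_one (x : ℝ) : x ^ 4 ≠ -1 := by
  intro h
  have : (0 : ℝ) ≤ x ^ 4 := by positivity
  linarith

end Shadow

end Summit.HodgeConjecture.HodgeConjecture.Cruxes.TwinTransportRMPicardTwo.Disproof
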